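import Literature.NumberTheory.ModularForms.DombEtaQuotientDerivatives
import Literature.NumberTheory.ModularForms.EisensteinE2LevelForms
import HarnessLib

/-!
# The level-6 forms `Δ₆ = tZ²`, `W = t²Z²` and `g = Dt/t` as modular forms on `Γ₀(6)`

Fifth file of the level-6 story of the four-step random walk ([BorweinEtAl2012, §4 Remark 7]:
`Z = η(τ)⁴η(3τ)⁴/(η(2τ)²η(6τ)²) ∈ M₂(Γ₀(6))`, `t = (η(2τ)η(6τ)/(η(τ)η(3τ)))⁶`, `dombModularForm`,
`dombHauptmodul*`). For the modular proof of the Chan–Zudilin parametrisation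
`y₀(−t) = Z` (Zagier's Prop. 21 for `Γ₀(6)`) only identities of weight `≤ 4` are needed (see the
plan in the seat notes); this file provides the remaining PLAYERS as genuine modular forms:

* `deltaSix = tZ² = (η(τ)η(2τ)η(3τ)η(6τ))² ∈ M₄(Γ₀(6))` (in fact the cusp form of `S₄(Γ₀(6))`) and
  `wSix = t²Z² = η(2τ)⁸η(6τ)⁸/(η(τ)⁴η(3τ)⁴) ∈ M₄(Γ₀(6))` (`deltaSixForm`, `wSixForm`, exponent
  identities `deltaSix_eq`, `wSix_eq`; Newman/Ligozat certificates by `decide`);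
* `gSix = (−Φ₂ + Φ₃ − Φ₆)/4 ∈ M₂(Γ₀(6))`, `Φ_δ = E₂ − δE₂(δ·)` (`gSixForm`), with
  **`t′ = 2πi · gSix · t`**, i.e. `Dt = t·gSix` (`deriv_dombT_eq`, from `logDeriv_dombT`);
* `hSix = (Φ₂ − 2Φ₃ + Φ₆)/12 ∈ M₂(Γ₀(6))` with `Z′ = 2πi (E₂/6 + hSix) Z`, i.e. the Serre
  derivative `ϑZ = DZ − E₂Z/6 = hSix · Z` (`deriv_dombZ_eq`).

## References

* [BorweinEtAl2012] J. M. Borwein, A. Straub, J. Wan, W. Zudilin, *Densities of short uniform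
  random walks*, Canad. J. Math. 64 (2012), §4 Remark 7.
* D. Zagier, *Elliptic modular forms and their applications* (2008), §5.4 Prop. 21. [Zagier2008]
-/

noncomputable section

open UpperHalfPlane hiding I
open Complex Filter Topology Finset EisensteinSeries ModularForm
open scoped Real MatrixGroups ModularForm Manifold

open Literature.NumberTheory.EllipticCurves.ModularForms

namespace Literature.NumberTheory.ModularForms

/-! ### Products of `η`-quotients -/

/-- `∏ η(δτ)^{r_δ} · ∏ η(δτ)^{r'_δ} = ∏ η(δτ)^{r_δ + r'_δ}`. [folklore] -/
theorem etaQuotient_mul (N : ℕ) (r r' : ℕ → ℤ) (τ : ℍ) :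
    etaQuotient N r τ * etaQuotient N r' τ = etaQuotient N (fun δ => r δ + r' δ) τ := by
  rw [etaQuotient_apply, etaQuotient_apply, etaQuotient_apply, ← Finset.prod_mul_distrib]
  refine Finset.prod_congr rfl fun δ hδ => ?_
  rw [← zpow_add₀ (eta_natMul_ne_zero (Nat.pos_of_mem_divisors hδ) τ.2)]

/-! ### `Δ₆ = tZ²` and `W = t²Z²` -/

/-- Exponents of `Δ₆ = (η(τ)η(2τ)η(3τ)η(6τ))²`. [folklore] -/
def deltaSixExponents : ℕ → ℤ := fun δ =>
  if δ = 1 then 2 else if δ = 2 then 2 else if δ = 3 then 2 else if δ = 6 then 2 else 0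

/-- Exponents of `W = η(2τ)⁸η(6τ)⁸/(η(τ)⁴η(3τ)⁴)`. [folklore] -/
def wSixExponents : ℕ → ℤ := fun δ =>
  if δ = 1 then -4 else if δ = 2 then 8 else if δ = 3 then -4 else if δ = 6 then 8 else 0

/-- **`Δ₆ = t · Z²`** as functions on `ℍ`. [folklore] -/
theorem deltaSix_eq (τ : ℍ) :
    etaQuotient 6 deltaSixExponents τ =
      etaQuotient 6 dombHauptmodulExponents τ * etaQuotient 6 dombExponents τ ^ 2 := by
  rw [sq, etaQuotient_mul, etaQuotient_mul]
  rw [etaQuotient_apply, etaQuotient_apply]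
  refine Finset.prod_congr rfl fun δ hδ => ?_
  have hmem : δ = 1 ∨ δ = 2 ∨ δ = 3 ∨ δ = 6 := by
    have : δ ∈ (6 : ℕ).divisors := hδ
    rw [show (6 : ℕ).divisors = {1, 2, 3, 6} by decide] at this
    simpa using this
  rcases hmem with rfl | rfl | rfl | rfl <;>
    simp [deltaSixExponents, dombHauptmodulExponents, dombExponents]

/-- **`W = t² · Z²`** as functions on `ℍ`. [folklore] -/
theorem wSix_eq (τ : ℍ) :
    etaQuotient 6 wSixExponents τ =
      etaQuotient 6 dombHauptmodulExponents τ ^ 2 * etaQuotient 6 dombExponents τ ^ 2 := by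
  rw [sq, sq, etaQuotient_mul, etaQuotient_mul, etaQuotient_mul]
  rw [etaQuotient_apply, etaQuotient_apply]
  refine Finset.prod_congr rfl fun δ hδ => ?_
  have hmem : δ = 1 ∨ δ = 2 ∨ δ = 3 ∨ δ = 6 := by
    have : δ ∈ (6 : ℕ).divisors := hδ
    rw [show (6 : ℕ).divisors = {1, 2, 3, 6} by decide] at this
    simpa using this
  rcases hmem with rfl | rfl | rfl | rfl <;>
    simp [wSixExponents, dombHauptmodulExponents, dombExponents]

/-- Newman's conditions for `Δ₆` in weight `4`. [folklore] -/
theorem newmanCond_deltaSixExponents : NewmanCond 6 deltaSixExponents 4 := by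
  refine ⟨by decide, by decide, by decide, ⟨36, by decide⟩⟩

/-- Ligozat orders of `Δ₆` are `≥ 0` (indeed `> 0`: a cusp form). [folklore] -/
theorem cuspOrder24_deltaSixExponents_nonneg :
    ∀ c ∈ (6 : ℕ).divisors, 0 ≤ cuspOrder24 6 deltaSixExponents c := by decide

/-- Newman's conditions for `W` in weight `4` (`∏ δ^{|r_δ|} = 2¹⁶3¹² = (2⁸3⁶)²`). [folklore] -/
theorem newmanCond_wSixExponents : NewmanCond 6 wSixExponents 4 := by
  refine ⟨by decide, by decide, by decide, ⟨2 ^ 8 * 3 ^ 6, by decide⟩⟩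

/-- Ligozat orders of `W` are `≥ 0` (`0, 96, 0, 288`). [folklore] -/
theorem cuspOrder24_wSixExponents_nonneg :
    ∀ c ∈ (6 : ℕ).divisors, 0 ≤ cuspOrder24 6 wSixExponents c := by decide

/-- **`Δ₆ = (η(τ)η(2τ)η(3τ)η(6τ))² ∈ M₄(Γ₀(6))`.** [folklore] -/
def deltaSixForm : ModularForm (CongruenceSubgroup.Gamma0 6) 4 :=
  etaQuotientModularForm 6 deltaSixExponents 4 (by decide) newmanCond_deltaSixExponents
    cuspOrder24_deltaSixExponents_nonneg

/-- **`W = η(2τ)⁸η(6τ)⁸/(η(τ)⁴η(3τ)⁴) ∈ M₄(Γ₀(6))`.** [folklore] -/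
def wSixForm : ModularForm (CongruenceSubgroup.Gamma0 6) 4 :=
  etaQuotientModularForm 6 wSixExponents 4 (by decide) newmanCond_wSixExponents
    cuspOrder24_wSixExponents_nonneg

/-- The underlying functions. [folklore] -/
theorem coe_deltaSixForm : (deltaSixForm : ℍ → ℂ) = etaQuotient 6 deltaSixExponents := rfl

/-- The underlying functions. [folklore] -/
theorem coe_wSixForm : (wSixForm : ℍ → ℂ) = etaQuotient 6 wSixExponents := rfl

/-! ### The weight-2 forms `gSix = Dt/t` and `hSix = ϑZ/Z` -/

/-- A `Γ₀(6)` element lies in `Γ₀(δ)` for `δ ∣ 6`. [folklore] -/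
theorem mem_Gamma0_of_dvd {δ : ℕ} (hδ : δ ∣ 6) {γ : SL(2, ℤ)} (hγ : γ ∈ CongruenceSubgroup.Gamma0 6) :
    γ ∈ CongruenceSubgroup.Gamma0 δ := by
  rw [CongruenceSubgroup.Gamma0_mem] at hγ ⊢
  rw [ZMod.intCast_zmod_eq_zero_iff_dvd] at hγ ⊢
  exact (Int.natCast_dvd_natCast.mpr hδ).trans hγ

/-- A linear combination `a Φ₂ + b Φ₃ + c Φ₆` of the level-2, 3, 6 Eisenstein series, viewed on
`Γ₀(6)`. [folklore] -/
def phiComb (a b c : ℂ) (τ : ℍ) : ℂ :=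
  a * phiE2 2 (by norm_num) τ + b * phiE2 3 (by norm_num) τ + c * phiE2 6 (by norm_num) τ

/-- Slash-invariance of `a Φ₂ + b Φ₃ + c Φ₆` under `Γ₀(6)`. [folklore] -/
theorem phiComb_slash (a b c : ℂ) {γ : SL(2, ℤ)} (hγ : γ ∈ CongruenceSubgroup.Gamma0 6) :
    phiComb a b c ∣[(2 : ℤ)] γ = phiComb a b c := by
  funext τ
  rw [SL_slash_apply, ModularGroup.denom_apply]
  have h2 := phiE2_smul 2 (by norm_num) (mem_Gamma0_of_dvd (by norm_num) hγ) τ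
  have h3 := phiE2_smul 3 (by norm_num) (mem_Gamma0_of_dvd (by norm_num) hγ) τ
  have h6 := phiE2_smul 6 (by norm_num) hγ τ
  simp only [phiComb, h2, h3, h6]
  have hj : (γ 1 0 : ℂ) * τ + γ 1 1 ≠ 0 := SL2_denom_ne_zero γ τ
  rw [zpow_neg, zpow_ofNat]
  field_simp

/-- `a Φ₂ + b Φ₃ + c Φ₆ ∈ M₂(Γ₀(6))`. [folklore] -/
def phiCombForm (a b c : ℂ) : ModularForm (CongruenceSubgroup.Gamma0 6) 2 where
  toFun := phiComb a b c
  slash_action_eq' A hA := by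
    obtain ⟨γ, hγ, rfl⟩ := hA
    exact phiComb_slash a b c hγ
  holo' := by
    show MDiff (phiComb a b c)
    unfold phiComb
    exact ((mdifferentiable_phiE2 2 (by norm_num)).const_smul a |>.add
      ((mdifferentiable_phiE2 3 (by norm_num)).const_smul b)).add
      ((mdifferentiable_phiE2 6 (by norm_num)).const_smul c)
  bdd_at_cusps' hcusp := by
    rw [Subgroup.IsArithmetic.isCusp_iff_isCusp_SL2Z] at hcusp
    rw [OnePoint.isBoundedAt_iff_forall_SL2Z hcusp]
    intro γ _
    have hfun : phiComb a b c ∣[(2 : ℤ)] γ = fun τ =>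
        a * (phiE2 2 (by norm_num) ∣[(2 : ℤ)] γ) τ + b * (phiE2 3 (by norm_num) ∣[(2 : ℤ)] γ) τ +
          c * (phiE2 6 (by norm_num) ∣[(2 : ℤ)] γ) τ := by
      funext τ
      simp only [SL_slash_apply, phiComb]
      ring
    show IsBoundedAtImInfty (phiComb a b c ∣[(2 : ℤ)] (γ : GL (Fin 2) ℝ))
    rw [← ModularForm.SL_slash, hfun]
    exact (((isBoundedAtImInfty_phiE2_slash 2 (by norm_num) γ).const_mul_left a).add
      ((isBoundedAtImInfty_phiE2_slash 3 (by norm_num) γ).const_mul_left b)).add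
      ((isBoundedAtImInfty_phiE2_slash 6 (by norm_num) γ).const_mul_left c)

/-- The underlying function. [folklore] -/
theorem coe_phiCombForm (a b c : ℂ) : (phiCombForm a b c : ℍ → ℂ) = phiComb a b c := rfl

/-- **`gSix := (−Φ₂ + Φ₃ − Φ₆)/4 = (1/4)(−E₂(τ) + 2E₂(2τ) − 3E₂(3τ) + 6E₂(6τ))`**, the weight-2 form
`Dt/t`. [cite: BorweinEtAl2012, §4 Remark 7] -/
def gSixForm : ModularForm (CongruenceSubgroup.Gamma0 6) 2 := phiCombForm (-(1 / 4)) (1 / 4) (-(1 / 4))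

/-- **`hSix := (Φ₂ − 2Φ₃ + Φ₆)/12`**, the weight-2 form `ϑZ/Z` (`ϑ` the Serre derivative).
[cite: BorweinEtAl2012, §4 Remark 7] -/
def hSixForm : ModularForm (CongruenceSubgroup.Gamma0 6) 2 := phiCombForm (1 / 12) (-(1 / 6)) (1 / 12)

/-- `gSix` in terms of `E₂(δτ)`. [folklore] -/
theorem gSixForm_apply (τ : ℍ) :
    gSixForm τ = (1 / 4) * (-E2 (sixMulPt 1 τ) + 2 * E2 (sixMulPt 2 τ) - 3 * E2 (sixMulPt 3 τ) +
      6 * E2 (sixMulPt 6 τ)) := by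
  show phiComb _ _ _ τ = _
  simp only [phiComb, phiE2, sixMulPt_of_pos one_pos, sixMulPt_of_pos (by norm_num : 0 < 2),
    sixMulPt_of_pos (by norm_num : 0 < 3), sixMulPt_of_pos (by norm_num : 0 < 6)]
  have h1 : natMulPt 1 one_pos τ = τ := by
    apply UpperHalfPlane.ext; simp [coe_natMulPt]
  rw [h1]
  push_cast
  ring

/-- `hSix` in terms of `E₂(δτ)`: `hSix = (1/6)(E₂(τ) − E₂(2τ) + 3E₂(3τ) − 3E₂(6τ)) − E₂(τ)/6`.
[folklore] -/
theorem hSixForm_apply (τ : ℍ) :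
    hSixForm τ = (1 / 6) * (E2 (sixMulPt 1 τ) - E2 (sixMulPt 2 τ) + 3 * E2 (sixMulPt 3 τ) -
      3 * E2 (sixMulPt 6 τ)) - E2 τ / 6 := by
  show phiComb _ _ _ τ = _
  simp only [phiComb, phiE2, sixMulPt_of_pos one_pos, sixMulPt_of_pos (by norm_num : 0 < 2),
    sixMulPt_of_pos (by norm_num : 0 < 3), sixMulPt_of_pos (by norm_num : 0 < 6)]
  have h1 : natMulPt 1 one_pos τ = τ := by
    apply UpperHalfPlane.ext; simp [coe_natMulPt]
  rw [h1]
  push_cast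
  ring

/-- **`t′(τ) = 2πi · gSix(τ) · t(τ)`**, i.e. `Dt = t · gSix` for `D = (2πi)⁻¹d/dτ`.
[cite: BorweinEtAl2012, §4 Remark 7] -/
theorem deriv_dombT_eq (τ : ℍ) :
    deriv (etaQuotientC 6 dombHauptmodulExponents) (τ : ℂ) =
      2 * π * I * gSixForm τ * etaQuotient 6 dombHauptmodulExponents τ := by
  have h := logDeriv_dombT τ
  have hne : etaQuotientC 6 dombHauptmodulExponents τ ≠ 0 := etaQuotient_ne_zero 6 _ τ
  rw [logDeriv_apply, div_eq_iff hne] at h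
  rw [h, gSixForm_apply, etaQuotient]
  ring

/-- **`Z′(τ) = 2πi · (E₂(τ)/6 + hSix(τ)) · Z(τ)`**, i.e. `DZ = (E₂/6 + hSix) Z` and the Serre
derivative `ϑZ = DZ − E₂Z/6 = hSix · Z`. [cite: BorweinEtAl2012, §4 Remark 7] -/
theorem deriv_dombZ_eq (τ : ℍ) :
    deriv (etaQuotientC 6 dombExponents) (τ : ℂ) =
      2 * π * I * (E2 τ / 6 + hSixForm τ) * etaQuotient 6 dombExponents τ := by
  have h := logDeriv_dombZ τ
  have hne : etaQuotientC 6 dombExponents τ ≠ 0 := etaQuotient_ne_zero 6 _ τ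
  rw [logDeriv_apply, div_eq_iff hne] at h
  rw [h, hSixForm_apply, etaQuotient]
  ring

end Literature.NumberTheory.ModularForms

end
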